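import Mathlib
import Summits.QuantumFields.YangMills.Theses.LangevinControlUV

/-!
# Route `LangevinControlUV` — item `MarginalFlowLemma` (stmt-QuantumFields-9368)

The "borderline summable" bookkeeping lemma for a marginal one-loop flow
`x_{j+1} = x_j - b x_j² + O(x_j³)` (`b > 0`): for small `0 < x₀ ≤ δ` the sequence stays
positive, obeys the two-sided reciprocal bounds `1/x₀ + bj/2 ≤ 1/x_j ≤ 1/x₀ + 2bj`, hence
`1/(1/x₀ + 2bj) ≤ x_j ≤ 1/(1/x₀ + bj/2)`, and `∑ x_j² ≤ (2/b) x₀`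
(so `Σ x_j = ∞` while `Σ x_j² < ∞`).

Proof: with `δ = b / (4b² + 4C + 1)` one has `bδ ≤ 1/4`, `Cδ ≤ b/4`; a one-step real
inequality (`marginalFlow_one_step`) propagates the invariant by induction, and
`x_j² ≤ (2/b)(x_j - x_{j+1})` telescopes for the sum (no integral test).  Elementary; the
printed sources (Gawędzki–Kupiainen 1985; Bauerschmidt–Brydges–Slade 2019, Ch. 6) state only
the asymptotics `x_j ≍ 1/(1/x₀ + bj)`.
-/

namespace Summit.QuantumFields.YangMills.Theorems.LangevinControlUV

open Finset

/-- One step of the marginal flow: if `0 < u`, `b u ≤ 1/4`, `C u ≤ b/4` and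
`u - b u² - C u³ ≤ v ≤ u - b u² + C u³`, then `0 < v ≤ u` and
`1/u + b/2 ≤ 1/v ≤ 1/u + 2b`. [folklore] -/
theorem marginalFlow_one_step {b C u v : ℝ} (hb : 0 < b) (hu : 0 < u) (hbu : b * u ≤ 1 / 4)
    (hCu : C * u ≤ b / 4) (hv1 : u - b * u ^ 2 - C * u ^ 3 ≤ v)
    (hv2 : v ≤ u - b * u ^ 2 + C * u ^ 3) :
    0 < v ∧ v ≤ u ∧ 1 / u + b / 2 ≤ 1 / v ∧ 1 / v ≤ 1 / u + 2 * b := by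
  have hu2 : 0 < u ^ 2 := by positivity
  -- `C u² ≤ b u / 4 ≤ 1/16`
  have h1 : C * u ^ 2 ≤ b * u / 4 := by nlinarith [mul_le_mul_of_nonneg_left hCu hu.le]
  have h2 : C * u ^ 2 ≤ 1 / 16 := by linarith
  -- positivity of the next term: `v ≥ u (1 - b u - C u²) ≥ (11/16) u`
  have hv_low : u * (11 / 16) ≤ v := by
    nlinarith [mul_le_mul_of_nonneg_left hbu hu.le, mul_le_mul_of_nonneg_left h2 hu.le]
  have hv : 0 < v := by nlinarith
  refine ⟨hv, ?_, ?_, ?_⟩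
  · -- `v ≤ u - b u² + C u³ ≤ u` since `C u ≤ b`
    nlinarith [mul_le_mul_of_nonneg_left hCu hu2.le]
  · -- `1/u + b/2 ≤ 1/v` iff `(2 + b u) v ≤ 2 u`
    rw [div_add_div _ _ hu.ne' two_ne_zero, div_le_div_iff₀ (by positivity) hv]
    have h3 : 2 * C * u + b * (C * u ^ 2) ≤ b + b ^ 2 * u := by nlinarith
    have h4 : (2 + b * u) * (u - b * u ^ 2 + C * u ^ 3) ≤ 2 * u := by
      nlinarith [mul_le_mul_of_nonneg_left h3 hu2.le]
    nlinarith [mul_le_mul_of_nonneg_left hv2 (by positivity : (0 : ℝ) ≤ 1 * 2 + b * u)]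
  · -- `1/v ≤ 1/u + 2 b` iff `u ≤ (1 + 2 b u) v`
    rw [div_add' _ _ _ hu.ne', div_le_div_iff₀ hv hu]
    have h3 : C * u + 2 * b ^ 2 * u + 2 * b * (C * u ^ 2) ≤ b := by nlinarith
    have h4 : u ≤ (1 + 2 * b * u) * (u - b * u ^ 2 - C * u ^ 3) := by
      nlinarith [mul_le_mul_of_nonneg_left h3 hu2.le]
    nlinarith [mul_le_mul_of_nonneg_left hv1 (by positivity : (0 : ℝ) ≤ 1 + 2 * b * u)]

/-- **MarginalFlowLemma** (item stmt-QuantumFields-9368 of route `LangevinControlUV`): the marginal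
one-loop flow `x_{j+1} = x_j - b x_j² + O(x_j³)` started at small `x₀ > 0` satisfies
`1/(1/x₀ + 2bj) ≤ x_j ≤ 1/(1/x₀ + bj/2)` for all `j` and `∑ x_j² ≤ K x₀`; here with the
explicit constants `δ = b/(4b² + 4C + 1)` and `K = 2/b`. [folklore] -/
theorem marginalFlowLemma_proof :
    Summit.QuantumFields.YangMills.Theses.LangevinControlUV.MarginalFlowLemma := by
  unfold Summit.QuantumFields.YangMills.Theses.LangevinControlUV.MarginalFlowLemma
  intro b C hb hC
  have hD : 0 < 4 * b ^ 2 + 4 * C + 1 := by positivity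
  refine ⟨b / (4 * b ^ 2 + 4 * C + 1), 2 / b, by positivity, by positivity, ?_⟩
  intro x hx0 hxδ hstep
  set δ : ℝ := b / (4 * b ^ 2 + 4 * C + 1) with hδ_def
  -- the two smallness conditions on `δ`
  have hbδ : b * δ ≤ 1 / 4 := by
    rw [hδ_def, ← mul_div_assoc, div_le_iff₀ hD]; nlinarith [sq_nonneg b]
  have hCδ : C * δ ≤ b / 4 := by
    rw [hδ_def, ← mul_div_assoc, div_le_div_iff₀ hD (by norm_num)]; nlinarith [mul_pos hb hb]
  -- the invariant, by induction on `j`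
  have key : ∀ j : ℕ, 0 < x j ∧ x j ≤ x 0 ∧ 1 / x 0 + b * j / 2 ≤ 1 / x j ∧
      1 / x j ≤ 1 / x 0 + 2 * b * j := by
    intro j
    induction j with
    | zero => simp [hx0]
    | succ j ih =>
      obtain ⟨hpos, hle, hlow, hup⟩ := ih
      have hbu : b * x j ≤ 1 / 4 := (mul_le_mul_of_nonneg_left (hle.trans hxδ) hb.le).trans hbδ
      have hCu : C * x j ≤ b / 4 := (mul_le_mul_of_nonneg_left (hle.trans hxδ) hC).trans hCδ
      obtain ⟨h1, h2⟩ := abs_le.mp (hstep j)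
      obtain ⟨hv, hvu, hvlow, hvup⟩ :=
        marginalFlow_one_step hb hpos hbu hCu (by linarith) (by linarith)
      refine ⟨hv, hvu.trans hle, ?_, ?_⟩
      · push_cast; linarith
      · push_cast; linarith
  -- the telescoping bound on partial sums of `x_j²`
  have hsq : ∀ j, x j ^ 2 ≤ 2 / b * (x j - x (j + 1)) := by
    intro j
    obtain ⟨hpos, hle, -, -⟩ := key j
    have hCu : C * x j ≤ b / 4 := (mul_le_mul_of_nonneg_left (hle.trans hxδ) hC).trans hCδ
    obtain ⟨-, h2⟩ := abs_le.mp (hstep j)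
    have h3 : b * x j ^ 2 / 2 ≤ x j - x (j + 1) := by
      nlinarith [mul_le_mul_of_nonneg_left hCu (sq_nonneg (x j))]
    calc x j ^ 2 = 2 / b * (b * x j ^ 2 / 2) := by field_simp
      _ ≤ 2 / b * (x j - x (j + 1)) := by gcongr
  have hpartial : ∀ n, ∑ i ∈ range n, x i ^ 2 ≤ 2 / b * x 0 := by
    intro n
    calc ∑ i ∈ range n, x i ^ 2
        ≤ ∑ i ∈ range n, 2 / b * (x i - x (i + 1)) := sum_le_sum fun i _ => hsq i
      _ = 2 / b * (x 0 - x n) := by rw [← mul_sum, sum_range_sub']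
      _ ≤ 2 / b * x 0 := by
        have := (key n).1
        gcongr; linarith
  refine ⟨fun j => ?_, summable_of_sum_range_le (fun j => sq_nonneg (x j)) hpartial,
    Real.tsum_le_of_sum_range_le (fun j => sq_nonneg (x j)) hpartial⟩
  obtain ⟨hpos, -, hlow, hup⟩ := key j
  have hx0' : 0 < 1 / x 0 := by positivity
  constructor
  · simpa only [one_div_one_div] using one_div_le_one_div_of_le (by positivity) hup
  · simpa only [one_div_one_div] using one_div_le_one_div_of_le (by positivity) hlow

end Summit.QuantumFields.YangMills.Theorems.LangevinControlUV
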